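import Literature.Claims.NS.ClayTorusBridge
import Literature.Analysis.FluidPDE.LerayHopf
import Literature.Analysis.FunctionSpaces.TorusSobolevNorm
import Literature.Analysis.FunctionSpaces.TorusFluidGlue
import Literature.Analysis.FunctionSpaces.TorusSpaceTime
import Literature.Analysis.FunctionSpaces.TorusClassicalNSUniqueness
import Literature.Analysis.FluidPDE.NSHopfExistenceProofs
import Literature.Analysis.FluidPDE.DissipationAnomalyProofs
import Mathlib.MeasureTheory.Integral.IntervalIntegral.Basic
import HarnessLib

/-!
# Claim skeleton (D-0090 NS-CLAIMS, C138, T3 QUICK): Liu Yong 2026 — «三维纳维-斯托克斯方程全局光滑解的存在性 … 千禧年问题证明»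
# [Existence of global smooth solutions of the 3D Navier–Stokes equations … a proof of the Millennium problem]

Typed skeleton (ns-claims-typist-7 g5; RULINGS v1.31j (2), QUICK grain) of 刘勇 (Liu Yong), Zenodo record
19681795 = doi:10.5281/zenodo.19681795 (ONE version; published 2026-04-21, created 2026-04-23; «Thesis»; CC-BY;
60 pp.; CHINESE; PDF sha16 c63e977294c6511e) = bib `LiuYong2026`. Sources `pub/ns-claims/sources/LiuYong2026/`
(`pages/p001–p060.txt`, `renders/pNNN.png`, `LOCATORS.md`, and the literal English `TRANSLATION-en.md` v3 sha16
4b506ee80d462a93 by ns-claims-lit-1 g8 — every formula below was read on the renders p003/p016–p019/p057 and on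
the translation; locators «p.N Lk» = PDF page N, line k of `pages/pNNN.txt`). UNREFEREED CLAIM under
adjudication — NOTHING in this file asserts a step of the paper: its statements are `def … : Prop`; the
`theorem`s are kernel-checked relations between them. Card `pub/ns-claims/claims/LiuYong2026/CARD.md`
(PREDICTION §4 frozen 2026-08-27T06:55Z, sha16 a942b3a3d342e7f1).

## The claimed statement (定理1 [Thm 1] p.3 L3–L5 = 定理4.1 [Thm 4.1] p.15 L22–p.16 L1, verbatim)

«设 ν > 0, f ∈ C^∞(𝕋³×[0,∞)) 满足 ∇·f = 0, u₀ ∈ C^∞(𝕋³) 满足 ∇·u₀ = 0。则存在唯一解 u ∈ C^∞(𝕋³×[0,∞))³,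
p ∈ C^∞(𝕋³×[0,∞)) 满足三维不可压缩纳维-斯托克斯方程及初值条件 u(x,0) = u₀(x)。特别地，有限时间爆破不会发生。»
[tr. lit-1 g8: Let ν > 0, f ∈ C^∞(𝕋³×[0,∞)) with ∇·f = 0, u₀ ∈ C^∞(𝕋³) with ∇·u₀ = 0. Then there is a
unique solution u ∈ C^∞(𝕋³×[0,∞))³, p ∈ C^∞(𝕋³×[0,∞)) of the 3D incompressible NS equations with
u(x,0) = u₀(x). In particular, finite-time blow-up does not occur.] Equations (定义2.1 p.5): ∂ₜu + (u·∇)u =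
−∇p + νΔu + f, ∇·u = 0 on 𝕋³. TYPED on the unit flat torus `𝕋³ = UnitAddTorus (Fin 3)` over the tree's torus
vocabulary (`Torus.IsClassicalNSSolutionOn`, `Torus.IsSmoothSpaceTimeOn`, `Torus.IsSmooth`, `Torus.IsDivFree`)
as `ClaimedTheorem := ClaimedExistence ∧ ClaimedUniqueness`.

## Clay delta (CARD §3; reference `Literature.Claims.NS.ClayVariants` + `ClayTorusBridge`)

Nearest Clay statement **(B)** (`ClayVariants.clayPeriodic.Regularity`; §2.7 p.9 reads the CMI text and adopts
«the periodic boundary condition 𝕋³ in place of ℝ³, a variant explicitly allowed»; p.16 L2–L3: the ℝ³ case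
«can be handled similarly by localisation and decay arguments and is omitted» — (A) is asserted by analogy
only, recorded, not typed). Δ1 domain 𝕋³ «=» (torus-as-quotient vocabulary is no delta: `ClayTorusBridge`).
Δ2 equations standard «=». Δ3 FORCE: a smooth divergence-free f on 𝕋³×[0,∞) is CARRIED (no decay-in-time
hypothesis) — the claim is formally STRONGER than (B) (f ≡ 0) on this axis. Δ4 data `C^∞`, div-free «=» (8)
(no zero-mean clause printed; none needed: `ClayTorusBridge`). Δ5 solution class `C^∞(𝕋³×[0,∞))` «=» (11).
Δ6 conclusion existence + UNIQUENESS (extra) «=»/stronger. Δ7 every ν > 0 «=». K41 is NOT a hypothesis of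
Thm 1 — it is DERIVED on the printed path (Lemma 4.2 + Ch. 3 ⇒ Prop 4.4 p.18 L22–23) ⇒ no «conditional» cell.
CLAY LINK — PROVED below: `clayB_of_claimed : ClaimedTheorem → ClayVariants.clayPeriodic.Regularity`
(specialise f ≡ 0; `clayPeriodic_regularityAt_iff_torus`). Not a «wrong problem» row.

## Architecture as printed (§4.2 p.16 L4–L14 «four core steps»; Ch. 3 supplies the objects) and the typed steps

Ch. 2–3 objects (pp.7–14, TRANSLATION §15–§16): the renormalisation operator `(S_λu)(x,t) = λu(λx, λ²t)`, «for
periodic boundary conditions λ is restricted to positive integers» (定义2.12 p.8 L3–L6); PRIMITIVE PERIODIC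
ORBITS: non-trivial solutions γ with `S_λ^m γ = γ` for some λ > 1, m ≥ 1, their set Γ (定义2.13 p.8 L7–L12);
`μ_NS = Σ_{γ∈Γ}(E(γ)/e^{E(γ)})δ_{L(γ)}` (定义2.14, (3.1) p.10); 注3.1 [Remark 3.1] p.10: «Non-emptiness and
richness of Γ are guaranteed as follows … This section assumes Γ has been constructed in this way»; §3.1.3
p.11 Haar/Riesz uniqueness; 引理3.2 p.12 («support rigidity: no blow-up branch», with «dμ_NS(L) ~ C L^{−5/3}dL»);
定理3.3 p.14 trace formula. Ch. 4: 定理2.2 (Leray, p.5) gives a global weak solution u; STEP 1 §4.3 p.16–17: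
`𝓔(k,t) = ½|û(k,t)|²`, the Cesàro spectrum `Φ(k) = lim_{T→∞} T⁻¹∫₀ᵀ 𝓔(k,t)dt` — «this limit exists by the
ergodicity of the weak solution (which can be guaranteed by a renormalisation-group argument)» (p.17 L1) —
and `μ_spec` (4.1); STEP 2 引理4.2 p.17–18 `supp μ_spec = supp μ_NS`; STEP 3 引理4.3 p.18 (blow-up ⇒
non-power-law spectrum, «contradiction»); STEP 4 命题4.4 p.18 L19–p.19 L8: «by support coincidence … THERE IS A
CONSTANT C > 0 SUCH THAT FOR ALL SUFFICIENTLY LARGE k, Φ(k) ~ C k^{−5/3}» (p.18 L22–23) ⇒ «uniform boundedness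
of all Sobolev norms … ‖u(t)‖²_{H^s} ~ Σ_k (1+|k|²)^s Φ(k) ≤ C_s < ∞» (p.18 L24–p.19 L4, «see App. F» = 附录H
引理H.1 p.57) ⇒ `u ∈ L^∞([0,∞);H^m)` ∀m ⇒ `u ∈ C^∞(𝕋³×[0,∞))` by Sobolev embedding + time bootstrap
(p.19 L5–L7) ⇒ uniqueness «by the standard uniqueness theorem for smooth solutions [Temam 1977]» (p.19 L7).
引理H.1 p.57 L8–L17 (THE CENSUS-PREDICTED LOAD-BEARING DISPLAY): «Suppose Φ(k) ~ Ck^{−5/3} holds for k ≥ k₀, and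
Φ(k) is bounded at the infrared end. Then for every s ≥ 0 there is C_s with ‖u(t)‖²_{H^s} ≤ C_s < ∞ for all
t ≥ 0»; its proof averages in time («\overline{‖u‖²_{H^s}} = Σ(1+|k|²)^sΦ(k)»), notes that the −5/3 law alone
gives convergence for NO s ≥ 0 («2s − 5/3 < −3, i.e. s < −2/3? This seems contradictory»), supplies an
exponential ultraviolet tail «BY GLOBAL SMOOTHNESS, with the viscous cut-off scale η … Φ(k) decays exponentially
for k ≫ 1/η» (L13–L14), and passes from the time average to `sup_t` by one sentence («by the energy
inequality and standard estimates (see [1]) … (cf. [2, Lemma 3.2])», L15–L17).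

ORDER OF RECORD (print / dependency order; the composition consumes every binder except `Step2_orbits`
and `Step_L43`, which are printed GROUNDS of Steps 3–4 — `_` binders, documented):
* Step 0 = `Step0_Leray` — 定理2.2 p.5 (Leray–Hopf existence for the data of Thm 1; classical [Leray 1934,
  Hopf 1951]; DISCHARGED in-file: `Step0_Leray_holds`, from the tree theorem `hopf_existence_torus_holds`).
* Step 1 = `Step1_cesaro` — §4.3 p.16 L15–p.17 L1 (the Cesàro spectrum Φ(k) EXISTS for every weak solution).
* Step 2 = `Step2_orbits` — 注3.1 p.10 with 定义2.12–2.14 p.8 (Γ ≠ ∅: a non-trivial unforced weak solution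
  fixed by an INTEGER renormalisation `S_n^m`, n ≥ 2) — the ground of «μ_NS ≠ 0», i.e. of the constant
  «C > 0» consumed in Step 3.
* Step 3 = `Step3_K41` — 引理4.2 p.17 L4–p.18 L5 + 命题4.4 proof first sentence p.18 L22–L23 (+ 引理3.2 p.12 /
  定理5.1 p.21 for the exponent): every weak solution's Cesàro spectrum obeys `Φ(k) ~ C k^{−5/3}`, C > 0.
* Step 4 = `Step4_H1` — 附录H 引理H.1 p.57 L8–L17 = 命题4.4 p.18 L24–p.19 L4 (K41 ⇒ uniform-in-t `H^s` bounds,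
  all s ≥ 0); companions `Step4_H1_upper` (hypothesis at the grain the proof USES, «Φ(k) ≤ C|k|^{−5/3} for
  large k», L13) and `Step4_H1_abs` (HYGIENE 13: the same inference for an arbitrary time-dependent field with
  a Cesàro spectrum — nothing about Navier–Stokes is used between L11 and L14).
* Step 5 = `Step5_lift` — p.19 L4–L7 (uniform `H^m` bounds for all m ⇒ the weak solution is a.e. a classical
  solution on 𝕋³×[0,∞) attaining u₀; Sobolev embedding + time bootstrap).
* Step 6 = `Step6_unique` — p.19 L7 («[Temam 1977]»: uniqueness of classical solutions; classical;
  DISCHARGED in-file: `Step6_unique_holds` = `ClaimedUniqueness_holds`, from the tree theorem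
  `Torus.IsClassicalNSSolutionOn.velocity_unique_of_mem`).
* Recorded, not consumed: `Step_L43` — 引理4.3 p.18 L11–L13 («if there is a blow-up solution … ‖∇u(t)‖_{L²}
  diverging as t → T_* … then Φ(k) accumulates in the high-wavenumber region … non-power-law»).

COMPOSITION — PROVED: `claim_of_steps : Step0_Leray → Step1_cesaro → Step2_orbits → Step3_K41 → Step4_H1 →
Step5_lift → Step6_unique → ClaimedTheorem` (Steps 0, 1, 3, 4, 5, 6 USED; Step 2 `_`), and with the two
classical ends discharged `claim_of_steps₀ : Step1_cesaro → Step2_orbits → Step3_K41 → Step4_H1 → Step5_lift →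
ClaimedTheorem`. Also `step4_of_upper : Step4_H1_upper → Step4_H1`, `step4_upper_of_abs : Step4_H1_abs →
Step4_H1_upper`, `isK41Upper_of_isK41`; Clay link `clayB_of_claimed : ClaimedTheorem → clayPeriodic.Regularity`.

Kernel handles for the refuter (no verdict here; CARD §5): (i) `Step3_K41` at the Clay grain f ≡ 0: the REST
STATE `u ≡ 0` (datum 0, force 0) is a global Leray–Hopf solution with Cesàro spectrum Φ ≡ 0, for which no
C > 0 with Φ(k)|k|^{5/3} → C exists; more generally every unforced Leray–Hopf solution on 𝕋³ has summable Φ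
(energy inequality + Fatou), incompatible with a two-sided k^{−5/3} law on ℤ³ (Σ_{ℤ³∖0}|k|^{−5/3} = ∞) — so
`Step4_H1` restricted to f ≡ 0 has an EMPTY hypothesis class (vacuity handle), while `Step4_H1_upper` /
`Step4_H1_abs` carry the (B)-strength content with the printed circular UV tail («由全局光滑解» p.57 L13);
(ii) `Step2_orbits`: `S_{n^m}γ = γ` on t ≥ 0 gives ‖γ(t)‖_{L²} = n^m‖γ(n^{2m}t)‖_{L²} for all t ≥ 0 (x ↦ n•x
preserves Haar measure on 𝕋³), hence ‖γ(n^{−2mj}t)‖ = n^{mj}‖γ(t)‖ → ∞ along j unless γ(t) = 0 a.e., against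
the energy inequality sup_{s>0}‖γ(s)‖ ≤ ‖γ₀‖ (ref-2 g4 E1); (iii) `Step1_cesaro` for FORCED solutions: a parallel shear
`u = a(t) sin(2πx₂)e₁`, `f = (a′ + 4π²νa) sin(2πx₂)e₁` with `a²` having no Cesàro mean; (iv) `Step4_H1_abs`:
time-sparse high-mode bursts (small Cesàro spectrum, unbounded sup-t `H^s`).

REV 2 (append-only §F, typist HYGIENE at the Clay grain f ≡ 0; no step re-typed): for an UNFORCED global
Leray–Hopf solution the energy inequality bounds `∫₀ᵀ 𝓔(k,t)dt ≤ ½‖u₀‖²/ν` for every `T` and `k ≠ 0`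
(`4π²|k|²|û(k)|² ≤ ‖∇u‖²`), so the Cesàro spectrum exists and is `Φ ≡ 0` (`hasCesaroSpectrum_zero_of_unforced`,
`step1_cesaro_zeroForce` — the f ≡ 0 face of Step 1 is TRUE), any Cesàro spectrum of such a solution vanishes
(`cesaroSpectrum_eq_zero_of_unforced`), none is K41 (`not_isK41_of_unforced` — Step 3 fails for every unforced
datum), and the hypotheses of `Step4_H1` / `Step_L43` are contradictory at f ≡ 0
(`step4_hypotheses_vacuous_zeroForce` — the census-predicted vacuity in kernel form).

REV 3 (append-only §G, RULED (γ) lead-1 g4 07:47:20Z, records-grade): the ONE-SIDED face of Step 3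
`Step3_K41_upper` (conclusion `IsK41Upper`, p.57 L13 grain), `step3_upper_of_step3 : Step3_K41 → Step3_K41_upper`,
the face-fact `isK41Upper_of_unforced` (TRUE on the unforced face, C = 0, k₀ = 1), `infraredBounded_of_isK41Upper`,
and the composition VARIANT `claim_of_steps_upper : Step0_Leray → Step1_cesaro → Step2_orbits → Step3_K41_upper →
Step4_H1_upper → Step5_lift → Step6_unique → ClaimedTheorem` (+ `claim_of_steps_upper₀`).

WHAT THIS IS NOT: not a claim about NS regularity or blow-up; not a claim about any author beyond the typed
locator.
-/

noncomputable section

open Set MeasureTheory Filter Topology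
open scoped ContDiff ENNReal

namespace Literature.Claims.NS.LiuYong2026

open Literature.Analysis Literature.Analysis.FluidPDE Literature.Analysis.FunctionSpaces
open Literature.Claims.NS.ClayVariants

/-! ## A. Carriers and the printed objects of §4.3 / App. H -/

/-- `ℝ³` (velocity values). [cite: LiuYong2026, 定义2.1 p.5] -/
abbrev E3 : Type := EuclideanSpace ℝ (Fin 3)

/-- `ℂ³` (vector Fourier coefficients). [cite: LiuYong2026, §4.3 p.16] -/
abbrev C3 : Type := EuclideanSpace ℂ (Fin 3)

/-- The flat unit torus `𝕋³ = ℝ³/ℤ³` (the paper's periodic box, characters `e^{2πik·x}`, p.16).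
[cite: LiuYong2026, §2.7 p.9; §4.3 p.16] -/
abbrev T3 : Type := UnitAddTorus (Fin 3)

/-- The wave-vector lattice `ℤ³`. [cite: LiuYong2026, §4.3 p.16] -/
abbrev Z3 : Type := Fin 3 → ℤ

/-- The Euclidean length `|k|` of a wave vector (`√(Σ kᵢ²)`; the tree's `Torus.freqNormSq` is `|k|²`).
[cite: LiuYong2026, §2.1 p.5 (`‖u‖²_{H^s} = Σ (1+|k|²)^s |û(k)|²`)] -/
def klen (k : Z3) : ℝ := Real.sqrt (Torus.freqNormSq k)

/-- The vector Fourier coefficient `û(k) ∈ ℂ³` of a field on `𝕋³` (Mathlib `UnitAddTorus.mFourierCoeff` of the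
complexified field, as in the tree's `Torus.eSobolevNorm`). [cite: LiuYong2026, §4.3 p.16 L17–L18] -/
def coeff (v : T3 → E3) (k : Z3) : C3 :=
  UnitAddTorus.mFourierCoeff (EuclideanSpace.complexify ∘ v) k

/-- The instantaneous energy spectrum `𝓔(k,t) = ½|û(k,t)|²` of a slice (§4.3 p.16; App. H p.57 L12).
[cite: LiuYong2026, §4.3 p.16 L19–L20] -/
def modeEnergy (v : T3 → E3) (k : Z3) : ℝ :=
  (1 / 2 : ℝ) * ‖coeff v k‖ ^ 2

/-- `Φ` **is the Cesàro (long-time averaged) energy spectrum of `u`**: for every `k ≠ 0`,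
`T⁻¹ ∫₀ᵀ 𝓔(k,t) dt → Φ(k)` as `T → ∞` (§4.3 p.16 L21–p.17 L1: «Φ(k) = lim_{T→∞} (1/T)∫₀ᵀ 𝓔(k,t)dt; this limit
exists by the ergodicity of the weak solution»; mode `k = 0` is excluded as in the print's `k ∈ ℤ³∖{0}`).
[cite: LiuYong2026, §4.3 p.16 L21–p.17 L1] -/
def HasCesaroSpectrum (u : ℝ → T3 → E3) (Φ : Z3 → ℝ) : Prop :=
  ∀ k : Z3, k ≠ 0 →
    Tendsto (fun T : ℝ => T⁻¹ * ∫ t in (0 : ℝ)..T, modeEnergy (u t) k) atTop (𝓝 (Φ k))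

/-- **The K41 law as printed in the proof of Prop 4.4** (p.18 L22–L23: «存在常数 C > 0 使得对足够大的 k,
Φ(k) ~ Ck^{−5/3}»; Thm 2 p.3: «in the inertial range (k → ∞), Φ(k) ~ C ε^{2/3} k^{−5/3} … C > 0»): there is
`C > 0` with `Φ(k)·|k|^{5/3} → C` as `|k| → ∞` on the lattice (cofinite filter on `ℤ³`).
[cite: LiuYong2026, 命题4.4 proof p.18 L22–L23; 定理2 p.3 L6–L9] -/
def IsK41 (Φ : Z3 → ℝ) : Prop :=
  ∃ C : ℝ, 0 < C ∧ Tendsto (fun k : Z3 => Φ k * klen k ^ (5 / 3 : ℝ)) cofinite (𝓝 C)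

/-- **The K41 UPPER bound, at the grain the proof of Lemma H.1 uses it** (p.57 L13: «由于 Φ(k) ≤ C|k|^{−5/3}
对大 k»): `Φ(k) ≤ C|k|^{−5/3}` for `|k| ≥ k₀`. [cite: LiuYong2026, 引理H.1 proof p.57 L13] -/
def IsK41Upper (Φ : Z3 → ℝ) : Prop :=
  ∃ C k₀ : ℝ, ∀ k : Z3, k₀ ≤ klen k → Φ k ≤ C * klen k ^ (-(5 / 3 : ℝ))

/-- «Φ(k) 在红外端有界» — `Φ` is bounded at the infrared end (typed: bounded; on the lattice the infrared end is
a finite set). [cite: LiuYong2026, 引理H.1 p.57 L8] -/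
def InfraredBounded (Φ : Z3 → ℝ) : Prop :=
  ∃ B : ℝ, ∀ k : Z3, Φ k ≤ B

/-- **Uniform-in-time Sobolev bounds of every order** — the conclusion of Lemma H.1 p.57 L8–L10 / Prop 4.4
p.18 L24–p.19 L4: for every `s ≥ 0` there is `C_s` with `‖u(t)‖²_{H^s} ≤ C_s` for all `t ≥ 0`, the norm being
`‖v‖²_{H^s} = Σ_k (1+|k|²)^s |v̂(k)|²` (p.5) — the tree's EXTENDED spectral norm `Torus.eSobolevNorm s` of the
complexified slice (no junk value: an infinite norm violates the bound). [cite: LiuYong2026, 引理H.1 p.57 L8–L10] -/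
def UniformSobolevBounds (u : ℝ → T3 → E3) : Prop :=
  ∀ s : ℝ, 0 ≤ s → ∃ Cs : ℝ, ∀ t : ℝ, 0 ≤ t →
    Torus.eSobolevNorm s (EuclideanSpace.complexify ∘ u t) ^ 2 ≤ ENNReal.ofReal Cs

/-- **The renormalisation operator with an INTEGER scale factor** (定义2.12 p.8 L3–L6: «(S_λu)(x,t) =
λu(λx, λ²t) … 对周期边界条件, λ 限制为正整数, 此时 S_λ 将 𝕋³ 映到自身»): `(S_n u)(t, x) = n · u(n²t, n•x)`.
[cite: LiuYong2026, 定义2.12 p.8 L3–L6] -/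
def rescale (n : ℕ) (u : ℝ → T3 → E3) : ℝ → T3 → E3 :=
  fun t x => (n : ℝ) • u ((n : ℝ) ^ 2 * t) (n • x)

/-- **A primitive periodic orbit** (定义2.13 p.8 L7–L12 with 注3.1 p.10): a NON-TRIVIAL solution γ of the
Navier–Stokes equations — read, with Remark 3.1 («the Leray existence theorem ensures these orbits exist in
the weak topology») and Def 2.12 («S_λ preserves the form of the NS equations (without force)»), as a global
Leray–Hopf weak solution of the UNFORCED system from some `L²` datum — such that `S_λ^m γ = γ` for some integer
`λ = n ≥ 2` («λ > 1», integer in the periodic case) and `m ≥ 1`; `S_n^m = S_{n^m}` (iterate of Def 2.12);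
the fixed-point identity is asked on the solution's time domain `t ≥ 0` only (the slices of a Leray–Hopf
solution at negative times are unconstrained). Non-triviality: some slice `γ(t)`, `t > 0`, is not a.e. zero. [cite: LiuYong2026, 定义2.13 p.8 L7–L12; 注3.1 p.10] -/
def IsPeriodicOrbit (ν : ℝ) (γ : ℝ → T3 → E3) : Prop :=
  (∃ γ₀ : T3 → E3, MemLp γ₀ 2 volume ∧ Torus.IsGlobalLerayHopf ν 0 γ₀ γ) ∧
    (∃ t : ℝ, 0 < t ∧ ¬ (γ t =ᵐ[volume] 0)) ∧
      ∃ n m : ℕ, 2 ≤ n ∧ 1 ≤ m ∧ ∀ t : ℝ, 0 ≤ t → ∀ x : T3, rescale (n ^ m) γ t x = γ t x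

/-! ## B. The claimed statement (Thm 1 p.3 = Thm 4.1 p.15–16) -/

/-- **The data of Theorem 1** (p.3 L3–L4): `ν > 0`, a force `f ∈ C^∞(𝕋³×[0,∞))` with `∇·f = 0` (jointly
smooth on `[0,∞) × 𝕋³`, divergence free at every `t ≥ 0`), a datum `u₀ ∈ C^∞(𝕋³)` with `∇·u₀ = 0`.
[cite: LiuYong2026, 定理1 p.3 L3–L4; 定义2.1 p.5] -/
structure IsData (ν : ℝ) (f : ℝ → T3 → E3) (u₀ : T3 → E3) : Prop where
  /-- `ν > 0`. -/
  visc : 0 < ν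
  /-- `f ∈ C^∞(𝕋³ × [0,∞))`. -/
  force_smooth : Torus.IsSmoothSpaceTimeOn (Ici 0) f
  /-- `∇·f = 0` for `t ≥ 0`. -/
  force_divFree : ∀ t : ℝ, 0 ≤ t → Torus.IsDivFree (f t)
  /-- `u₀ ∈ C^∞(𝕋³)`. -/
  datum_smooth : Torus.IsSmooth u₀
  /-- `∇·u₀ = 0`. -/
  datum_divFree : Torus.IsDivFree u₀

/-- **Thm 1, existence clause** (p.3 L4–L5): for all data there are `u, p ∈ C^∞(𝕋³ × [0,∞))` solving the forced
system with `u(·,0) = u₀` («in particular, finite-time blow-up does not occur»).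
[claim: LiuYong2026, status: disputed] -/
def ClaimedExistence : Prop :=
  ∀ (ν : ℝ) (f : ℝ → T3 → E3) (u₀ : T3 → E3), IsData ν f u₀ →
    ∃ (U : ℝ → T3 → E3) (P : ℝ → T3 → ℝ), Torus.IsClassicalNSSolutionOn (Ici 0) ν f U P ∧ U 0 = u₀

/-- **Thm 1, uniqueness clause** («存在唯一解», p.3 L4; p.19 L7 «[Temam 1977]»): two classical solutions on
`𝕋³ × [0,∞)` of the forced system with the same datum have the same velocity for all `t ≥ 0`.
[claim: LiuYong2026, status: disputed] -/
def ClaimedUniqueness : Prop :=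
  ∀ (ν : ℝ) (f : ℝ → T3 → E3) (u₀ : T3 → E3), IsData ν f u₀ →
    ∀ (U U' : ℝ → T3 → E3) (P P' : ℝ → T3 → ℝ),
      Torus.IsClassicalNSSolutionOn (Ici 0) ν f U P → Torus.IsClassicalNSSolutionOn (Ici 0) ν f U' P' →
        U 0 = u₀ → U' 0 = u₀ → ∀ t : ℝ, 0 ≤ t → U t = U' t

/-- **The claimed statement, Theorem 1 p.3** (both clauses). [claim: LiuYong2026, status: disputed] -/
def ClaimedTheorem : Prop :=
  ClaimedExistence ∧ ClaimedUniqueness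

/-! ## C. The steps (print / dependency order) -/

/-- **Step 0 — 定理2.2 [Thm 2.2, Leray 1934 / periodic] p.5**, as used on p.16 L15 («by the Leray weak-solution
existence theorem there is a global weak solution u ∈ L^∞L²_σ ∩ L²_loc H¹_σ satisfying the energy inequality»):
for the data of Thm 1 there is a global Leray–Hopf weak solution (tree `Torus.IsGlobalLerayHopf`). Classical and
TRUE (tree THEOREM `hopf_existence_torus_holds` for `L²` forces on finite horizons — a jointly smooth force is
one); kept as a step because the chain starts from it. [claim: LiuYong2026, status: disputed] -/
def Step0_Leray : Prop :=
  ∀ (ν : ℝ) (f : ℝ → T3 → E3) (u₀ : T3 → E3), IsData ν f u₀ →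
    ∃ u : ℝ → T3 → E3, Torus.IsGlobalLerayHopf ν f u₀ u

/-- **Step 1 — §4.3 p.16 L21–p.17 L1** («define the time-averaged energy spectrum Φ(k) = lim_{T→∞}
(1/T)∫₀ᵀ𝓔(k,t)dt; this limit exists by the ergodicity of the weak solution (which can be guaranteed by a
renormalisation-group argument)»): EVERY global weak solution of the forced problem from the data of Thm 1 has
a Cesàro spectrum. [claim: LiuYong2026, status: disputed] -/
def Step1_cesaro : Prop :=
  ∀ (ν : ℝ) (f : ℝ → T3 → E3) (u₀ : T3 → E3), IsData ν f u₀ →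
    ∀ u : ℝ → T3 → E3, Torus.IsGlobalLerayHopf ν f u₀ u → ∃ Φ : Z3 → ℝ, HasCesaroSpectrum u Φ

/-- **Step 2 — 注3.1 [Remark 3.1] p.10 with 定义2.12–2.14 p.8** («Non-emptiness and richness of Γ are guaranteed
as follows: … linear orbits extend to nonlinear periodic orbits … The Leray existence theorem ensures these
orbits exist in the weak topology … This section assumes Γ has been constructed in this way»): for every
`ν > 0` the orbit set Γ is NON-EMPTY — there is a primitive periodic orbit (`IsPeriodicOrbit`). This is the
printed ground of `μ_NS ≠ 0` (3.1), hence of the constant «C > 0» consumed in Step 3 (p.18 L22).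
[claim: LiuYong2026, status: disputed] -/
def Step2_orbits : Prop :=
  ∀ ν : ℝ, 0 < ν → ∃ γ : ℝ → T3 → E3, IsPeriodicOrbit ν γ

/-- **Step 3 — 引理4.2 [Lemma 4.2] p.17 L4–p.18 L5 with the first sentence of the proof of 命题4.4 [Prop 4.4]
p.18 L22–L23** («by support coincidence the asymptotic behaviour of μ_spec is uniquely determined by μ_NS:
THERE IS A CONSTANT C > 0 SUCH THAT FOR ALL SUFFICIENTLY LARGE k, Φ(k) ~ Ck^{−5/3}»; exponent from 引理3.2 p.12
«dμ_NS(L) ~ CL^{−5/3}dL» / 定理5.1 p.21): the Cesàro spectrum of EVERY global weak solution of the forced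
problem obeys the K41 law with a positive constant. [claim: LiuYong2026, status: disputed] -/
def Step3_K41 : Prop :=
  ∀ (ν : ℝ) (f : ℝ → T3 → E3) (u₀ : T3 → E3), IsData ν f u₀ →
    ∀ (u : ℝ → T3 → E3) (Φ : Z3 → ℝ), Torus.IsGlobalLerayHopf ν f u₀ u → HasCesaroSpectrum u Φ → IsK41 Φ

/-- **Step 4 — 附录H 引理H.1 [App. H, Lemma H.1] p.57 L8–L17 = 命题4.4 p.18 L24–p.19 L4** («设 Φ(k) ~ Ck^{−5/3}
对 k ≥ k₀ 成立, 且 Φ(k) 在红外端有界。则对任意 s ≥ 0, 存在常数 C_s 使得 ‖u(t)‖²_{H^s} ≤ C_s < ∞, ∀t ≥ 0»), for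
the weak solution of the chain (the `u` of §4.3): K41 Cesàro spectrum ⇒ uniform-in-time `H^s` bounds of
every order. THE CENSUS-PREDICTED LOCATOR; its printed proof supplies the ultraviolet tail «由全局光滑解»
[by global smoothness] (L13–L14) and the time-average → sup-t passage by «见[1] … 参见[2, Lemma 3.2]» (L15–L17).
[claim: LiuYong2026, status: disputed] -/
def Step4_H1 : Prop :=
  ∀ (ν : ℝ) (f : ℝ → T3 → E3) (u₀ : T3 → E3), IsData ν f u₀ →
    ∀ (u : ℝ → T3 → E3) (Φ : Z3 → ℝ), Torus.IsGlobalLerayHopf ν f u₀ u → HasCesaroSpectrum u Φ →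
      IsK41 Φ → InfraredBounded Φ → UniformSobolevBounds u

/-- **Step 4 at the grain its proof USES** (HYGIENE 13; p.57 L13 «Φ(k) ≤ C|k|^{−5/3} 对大 k»): the same
inference from the K41 UPPER bound only (weaker hypothesis ⇒ stronger step; `step4_of_upper`).
[claim: LiuYong2026, status: disputed] -/
def Step4_H1_upper : Prop :=
  ∀ (ν : ℝ) (f : ℝ → T3 → E3) (u₀ : T3 → E3), IsData ν f u₀ →
    ∀ (u : ℝ → T3 → E3) (Φ : Z3 → ℝ), Torus.IsGlobalLerayHopf ν f u₀ u → HasCesaroSpectrum u Φ →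
      IsK41Upper Φ → InfraredBounded Φ → UniformSobolevBounds u

/-- **Step 4, abstract face** (HYGIENE 13): Lemma H.1 exactly as printed quantifies over a field `u` with a
Cesàro spectrum and uses nothing else between L11 and L14 — for ANY time-dependent field on `𝕋³` with
square-integrable slices whose Cesàro spectrum obeys the K41 upper bound and is infrared-bounded, the `H^s`
norms are bounded uniformly in `t ≥ 0` for every `s ≥ 0`. [claim: LiuYong2026, status: disputed] -/
def Step4_H1_abs : Prop :=
  ∀ (u : ℝ → T3 → E3) (Φ : Z3 → ℝ), (∀ t : ℝ, 0 ≤ t → MemLp (u t) 2 volume) → HasCesaroSpectrum u Φ →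
    IsK41Upper Φ → InfraredBounded Φ → UniformSobolevBounds u

/-- **Step 5 — p.19 L4–L7** («Hence u ∈ L^∞([0,∞); H^m(𝕋³)) for all m. By the Sobolev embedding theorem …
u is smooth in space. Differentiating the equation in time and using induction, u is also smooth in time.
Hence u ∈ C^∞(𝕋³ × [0,∞))»): a global weak solution of the forced problem from the data of Thm 1 with
uniform `H^s` bounds of every order agrees for `t > 0` a.e. with a classical solution on `𝕋³ × [0,∞)`
attaining `u₀`. [claim: LiuYong2026, status: disputed] -/
def Step5_lift : Prop :=
  ∀ (ν : ℝ) (f : ℝ → T3 → E3) (u₀ : T3 → E3), IsData ν f u₀ →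
    ∀ u : ℝ → T3 → E3, Torus.IsGlobalLerayHopf ν f u₀ u → UniformSobolevBounds u →
      ∃ (U : ℝ → T3 → E3) (P : ℝ → T3 → ℝ),
        Torus.IsClassicalNSSolutionOn (Ici 0) ν f U P ∧ U 0 = u₀ ∧ ∀ t : ℝ, 0 < t → u t =ᵐ[volume] U t

/-- **Step 6 — p.19 L7** («唯一性由光滑解的标准唯一性定理保证 (如 [Temam 1977])» — uniqueness of classical
solutions of the forced system on `𝕋³ × [0,∞)` with the same datum; classical, TRUE).
[claim: LiuYong2026, status: disputed] -/
def Step6_unique : Prop :=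
  ClaimedUniqueness

/-- **Recorded display — 引理4.3 [Lemma 4.3] p.18 L11–L13**, the one quantitative sentence of its proof («假设存在
一个爆破解, 则存在时间 T_* < ∞ 使得 ‖∇u(t)‖_{L²} 在 t → T_* 时发散。此时能量谱 Φ(k) 在大波数区会出现累积, 导致 …
非幂律行为»): a global weak solution of the chain whose `H¹` norm is unbounded on some `(0, T_*)`, `T_* < ∞`,
has a Cesàro spectrum that does NOT obey the K41 law. Not consumed by `claim_of_steps` (Lemma 4.3 enters
Prop 4.4 only through the sentence p.18 L16–L18). [claim: LiuYong2026, status: disputed] -/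
def Step_L43 : Prop :=
  ∀ (ν : ℝ) (f : ℝ → T3 → E3) (u₀ : T3 → E3), IsData ν f u₀ →
    ∀ (u : ℝ → T3 → E3) (Φ : Z3 → ℝ), Torus.IsGlobalLerayHopf ν f u₀ u → HasCesaroSpectrum u Φ →
      (∃ Ts : ℝ, 0 < Ts ∧ ∀ M : ℝ, ∃ t ∈ Ioo 0 Ts,
          ENNReal.ofReal M < Torus.eSobolevNorm 1 (EuclideanSpace.complexify ∘ u t)) →
        ¬ IsK41 Φ

/-! ## D. Kernel-checked relations (pure logic; nothing of the paper is asserted) -/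

/-- `|k| ≥ 0`. [folklore] -/
private theorem klen_nonneg (k : Z3) : 0 ≤ klen k := Real.sqrt_nonneg _

/-- The lattice points with `|k| < R` form a finite set (they lie in the cube `[-⌈R⌉, ⌈R⌉]³`). [folklore] -/
private theorem finite_klen_lt (R : ℝ) : {k : Z3 | klen k < R}.Finite := by
  classical
  refine (Set.Finite.pi (t := fun _ : Fin 3 => Set.Icc (-⌈R⌉) ⌈R⌉) fun _ => Set.finite_Icc _ _).subset ?_
  intro k hk i _
  simp only [Set.mem_setOf_eq] at hk
  have hR : 0 ≤ R := (klen_nonneg k).trans hk.le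
  have hsq : (k i : ℝ) ^ 2 ≤ Torus.freqNormSq k := by
    unfold Torus.freqNormSq
    exact Finset.single_le_sum (f := fun j => (k j : ℝ) ^ 2) (fun j _ => sq_nonneg _) (Finset.mem_univ i)
  have h1 : Torus.freqNormSq k < R ^ 2 := by
    have := hk
    unfold klen at this
    rw [show R = Real.sqrt (R ^ 2) by rw [Real.sqrt_sq hR]] at this
    exact (Real.sqrt_lt_sqrt_iff (Torus.freqNormSq_nonneg k)).1 this
  have habs : |(k i : ℝ)| ≤ R := by
    have : (k i : ℝ) ^ 2 ≤ R ^ 2 := (hsq.trans h1.le)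
    exact abs_le_of_sq_le_sq' this hR |>.elim (fun h1 h2 => abs_le.2 ⟨h1, h2⟩)
  have hceil : (R : ℝ) ≤ (⌈R⌉ : ℝ) := Int.le_ceil R
  constructor
  · have : -(⌈R⌉ : ℝ) ≤ (k i : ℝ) := by linarith [(abs_le.1 habs).1]
    exact_mod_cast this
  · have : (k i : ℝ) ≤ (⌈R⌉ : ℝ) := by linarith [(abs_le.1 habs).2]
    exact_mod_cast this

/-- **The asymptotic law implies the upper bound** (`Φ(k)|k|^{5/3} → C` ⇒ `Φ(k) ≤ (C+1)|k|^{−5/3}` for large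
`|k|`): the link between Step 3's conclusion («Φ(k) ~ Ck^{−5/3}», 命题4.4 p.18 L22–L23) and the hypothesis
Lemma H.1's proof USES («Φ(k) ≤ C|k|^{−5/3}» for k ≥ k₀, p.57 L13). [cite: LiuYong2026, 引理H.1 p.57 L8–L13] -/
theorem isK41Upper_of_isK41 {Φ : Z3 → ℝ} (h : IsK41 Φ) : IsK41Upper Φ := by
  classical
  obtain ⟨C, _, hC⟩ := h
  -- eventually (cofinite) `Φ k * |k|^{5/3} < C + 1`
  have hev : ∀ᶠ k : Z3 in cofinite, Φ k * klen k ^ (5 / 3 : ℝ) < C + 1 :=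
    hC.eventually (Iio_mem_nhds (by linarith))
  rw [Filter.eventually_cofinite] at hev
  -- the finite exceptional set lies in some ball `|k| < R`; take `k₀ = max R 1`
  obtain ⟨R, hR⟩ : ∃ R : ℝ, ∀ k ∈ {k : Z3 | ¬ Φ k * klen k ^ (5 / 3 : ℝ) < C + 1}, klen k < R := by
    obtain ⟨R, hR⟩ := (hev.image klen).bddAbove
    exact ⟨R + 1, fun k hk => lt_of_le_of_lt (hR (Set.mem_image_of_mem klen hk)) (by linarith)⟩
  refine ⟨C + 1, max R 1, fun k hk => ?_⟩
  have hkR : R ≤ klen k := (le_max_left R 1).trans hk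
  have hk1 : 1 ≤ klen k := (le_max_right R 1).trans hk
  have hkpos : 0 < klen k := lt_of_lt_of_le one_pos hk1
  have hlt : Φ k * klen k ^ (5 / 3 : ℝ) < C + 1 := by
    by_contra hnot
    exact absurd (hR k hnot) (not_lt.2 hkR)
  have hp : 0 < klen k ^ (5 / 3 : ℝ) := Real.rpow_pos_of_pos hkpos _
  rw [Real.rpow_neg hkpos.le, ← div_eq_mul_inv, le_div_iff₀ hp]
  exact hlt.le

/-- Step 4 at the used grain implies Step 4 as stated. [cite: LiuYong2026, 引理H.1 p.57 L8–L13] -/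
theorem step4_of_upper (h : Step4_H1_upper) : Step4_H1 :=
  fun ν f u₀ hd u Φ hu hΦ hK hB => h ν f u₀ hd u Φ hu hΦ (isK41Upper_of_isK41 hK) hB

/-- The abstract face implies the used-grain step (a Leray–Hopf solution has square-integrable slices).
[cite: LiuYong2026, 引理H.1 p.57] -/
theorem step4_upper_of_abs (h : Step4_H1_abs) : Step4_H1_upper := by
  intro ν f u₀ _ u Φ hu hΦ hK hB
  refine h u Φ (fun t ht => ?_) hΦ hK hB
  rcases eq_or_lt_of_le ht with rfl | ht'
  · exact (hu 1 one_pos).memLp 0 ⟨le_rfl, zero_le_one⟩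
  · exact (hu (t + 1) (by linarith)).memLp t ⟨ht, by linarith⟩

/-- **COMPOSITION** (§4.2 p.16 «four core steps» + 定理2.2 + p.19 L7) — PROVED. Steps 0, 1, 3, 4, 5, 6 are USED;
Step 2 (Γ ≠ ∅) is the printed ground of the constant «C > 0» inside Step 3 and carries a `_` binder.
[cite: LiuYong2026, §4.2 p.16 L4–L14; 命题4.4 p.18–19; 定理4.1 p.15] -/
theorem claim_of_steps (h0 : Step0_Leray) (h1 : Step1_cesaro) (_h2 : Step2_orbits) (h3 : Step3_K41)
    (h4 : Step4_H1) (h5 : Step5_lift) (h6 : Step6_unique) : ClaimedTheorem := by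
  refine ⟨fun ν f u₀ hd => ?_, h6⟩
  obtain ⟨u, hu⟩ := h0 ν f u₀ hd
  obtain ⟨Φ, hΦ⟩ := h1 ν f u₀ hd u hu
  have hK : IsK41 Φ := h3 ν f u₀ hd u Φ hu hΦ
  -- infrared boundedness on the lattice: finitely many modes below `k₀`, the K41 bound above
  have hB : InfraredBounded Φ := by
    classical
    obtain ⟨C, k₀, hCk⟩ := isK41Upper_of_isK41 hK
    have hfin : {k : Z3 | klen k < max k₀ 1}.Finite := finite_klen_lt _
    obtain ⟨B₀, hB₀⟩ := (hfin.image Φ).bddAbove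
    refine ⟨max B₀ (|C|), fun k => ?_⟩
    by_cases hk : klen k < max k₀ 1
    · exact (hB₀ (Set.mem_image_of_mem Φ hk)).trans (le_max_left _ _)
    · have hk' : max k₀ 1 ≤ klen k := not_lt.1 hk
      have hk1 : 1 ≤ klen k := (le_max_right k₀ 1).trans hk'
      have h1 : Φ k ≤ C * klen k ^ (-(5 / 3 : ℝ)) := hCk k ((le_max_left k₀ 1).trans hk')
      have h2 : klen k ^ (-(5 / 3 : ℝ)) ≤ 1 :=
        Real.rpow_le_one_of_one_le_of_nonpos hk1 (by norm_num)
      have h3 : C * klen k ^ (-(5 / 3 : ℝ)) ≤ |C| := by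
        have hnn : 0 ≤ klen k ^ (-(5 / 3 : ℝ)) := Real.rpow_nonneg (klen_nonneg k) _
        calc C * klen k ^ (-(5 / 3 : ℝ)) ≤ |C| * klen k ^ (-(5 / 3 : ℝ)) :=
              mul_le_mul_of_nonneg_right (le_abs_self C) hnn
          _ ≤ |C| * 1 := mul_le_mul_of_nonneg_left h2 (abs_nonneg C)
          _ = |C| := mul_one _
      exact (h1.trans h3).trans (le_max_right _ _)
  have hS : UniformSobolevBounds u := h4 ν f u₀ hd u Φ hu hΦ hK hB
  obtain ⟨U, P, hU, hU0, -⟩ := h5 ν f u₀ hd u hu hS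
  exact ⟨U, P, hU, hU0⟩

/-- **Step 0 holds** (Hopf's theorem on `𝕋³`, tree THEOREM `hopf_existence_torus_holds`; a jointly smooth
force is measurable and square-integrable on every `(0,T) × 𝕋³` — `Torus.IsSmoothSpaceTimeOn.aestronglyMeasurable_stLift`,
`….exists_norm_le_of_isCompact`; a smooth datum is `L²` and weakly divergence free). Recorded so that the
adjudication concerns the paper's own steps. [cite: Hopf1951, Math. Nachr. 4] -/
theorem Step0_Leray_holds : Step0_Leray := by
  intro ν f u₀ hd
  have hν := hd.visc
  have hL2 : MemLp u₀ 2 volume := hd.datum_smooth.memLp 2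
  have hwdiv : Torus.IsWeaklyDivFree u₀ :=
    Torus.IsDivFree.isWeaklyDivFree_holds hd.datum_smooth hd.datum_divFree
  have hmeas : AEStronglyMeasurable (Torus.stLift f) (volume.restrict (Ioi 0 ×ˢ univ)) :=
    hd.force_smooth.aestronglyMeasurable_stLift measurableSet_Ioi Ioi_subset_Ici_self
  have hfin : ∀ T : ℝ, 0 < T → ∫⁻ t in Ioo 0 T, ∫⁻ x, ‖f t x‖ₑ ^ 2 < ⊤ := by
    intro T _
    obtain ⟨C, hC⟩ := hd.force_smooth.exists_norm_le_of_isCompact isCompact_Icc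
      (Icc_subset_Ici_self : Icc (0 : ℝ) T ⊆ Ici 0)
    have hpt : ∀ t ∈ Ioo (0 : ℝ) T, ∀ x : T3, ‖f t x‖ₑ ^ 2 ≤ ENNReal.ofReal (C ^ 2) := by
      intro t ht x
      have h1 : ‖f t x‖ ≤ C := hC t ⟨ht.1.le, ht.2.le⟩ x
      rw [← ofReal_norm, ← ENNReal.ofReal_pow (norm_nonneg _)]
      exact ENNReal.ofReal_le_ofReal (pow_le_pow_left₀ (norm_nonneg _) h1 2)
    have hslice : ∀ t ∈ Ioo (0 : ℝ) T,
        ∫⁻ x, ‖f t x‖ₑ ^ 2 ≤ ENNReal.ofReal (C ^ 2) * volume (univ : Set T3) := by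
      intro t ht
      calc ∫⁻ x, ‖f t x‖ₑ ^ 2 ≤ ∫⁻ _ : T3, ENNReal.ofReal (C ^ 2) := lintegral_mono fun x => hpt t ht x
        _ = ENNReal.ofReal (C ^ 2) * volume (univ : Set T3) := lintegral_const _
    have hle : ∫⁻ t in Ioo 0 T, ∫⁻ x, ‖f t x‖ₑ ^ 2 ≤
        ∫⁻ _ in Ioo (0 : ℝ) T, ENNReal.ofReal (C ^ 2) * volume (univ : Set T3) :=
      setLIntegral_mono' measurableSet_Ioo fun t ht => hslice t ht
    refine lt_of_le_of_lt hle ?_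
    rw [setLIntegral_const]
    exact ENNReal.mul_lt_top (ENNReal.mul_lt_top ENNReal.ofReal_lt_top (measure_lt_top _ _))
      measure_Ioo_lt_top
  exact hopf_existence_torus_holds ν hν u₀ hL2 hwdiv f hmeas hfin

/-- **The uniqueness clause of Theorem 1 holds** (classical: Majda–Bertozzi Cor. 3.1 on `𝕋³`, tree THEOREM
`Torus.IsClassicalNSSolutionOn.velocity_unique_of_mem`, forward from `t₀ = 0` on the convex time set `[0,∞)`).
[cite: MajdaBertozziCUP2002, Cor. 3.1] -/
theorem ClaimedUniqueness_holds : ClaimedUniqueness := by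
  intro ν f u₀ hd U U' P P' hU hU' h0 h0' t ht
  exact hU.velocity_unique_of_mem hd.visc.le (convex_Ici 0) hU' (t₀ := 0) (by simp)
    (h0.trans h0'.symm) (by simpa using ht) ht

/-- **Step 6 holds** (it IS the uniqueness clause). [cite: MajdaBertozziCUP2002, Cor. 3.1] -/
theorem Step6_unique_holds : Step6_unique := ClaimedUniqueness_holds

/-- **COMPOSITION with the classical ends discharged**: the paper's own Steps 1, 3, 4, 5 (and the ground
Step 2, `_`) imply Theorem 1. [cite: LiuYong2026, §4.2 p.16 L4–L14] -/
theorem claim_of_steps₀ (h1 : Step1_cesaro) (_h2 : Step2_orbits) (h3 : Step3_K41) (h4 : Step4_H1)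
    (h5 : Step5_lift) : ClaimedTheorem :=
  claim_of_steps Step0_Leray_holds h1 _h2 h3 h4 h5 Step6_unique_holds

/-! ## E. Clay link (PROVED): the claim implies Clay (B) -/

/-- The zero force is a datum-admissible force of Thm 1: jointly smooth and divergence free.
[cite: LiuYong2026, 定理1 p.3 (f ≡ 0 is allowed)] -/
theorem isData_zero_force {ν : ℝ} (hν : 0 < ν) {u₀ : T3 → E3} (hs : Torus.IsSmooth u₀)
    (hd : Torus.IsDivFree u₀) : IsData ν (0 : ℝ → T3 → E3) u₀ := by
  refine ⟨hν, ?_, fun t _ x => ?_, hs, hd⟩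
  · have : Torus.stLift (0 : ℝ → T3 → E3) = fun _ => 0 := rfl
    show ContDiffOn ℝ ∞ (Torus.stLift (0 : ℝ → T3 → E3)) (Ici 0 ×ˢ Set.univ)
    rw [this]
    exact contDiffOn_const
  · simp [Torus.divergence, Torus.partialDeriv, Torus.lineDeriv]

/-- **Clay link**: Theorem 1 (existence clause, at f ≡ 0) implies Fefferman's (B) — torus vocabulary bridge
`clayPeriodic_regularityAt_iff_torus`. No «wrong problem» axis: the claim is (B) with a force carried and
uniqueness added. [cite: FeffermanClay2006, (B) with (8) (10) (11) p. 2] -/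
theorem clayB_of_claimed (h : ClaimedTheorem) : clayPeriodic.Regularity := by
  intro ν hν
  rw [clayPeriodic_regularityAt_iff_torus hν]
  intro U₀ hs hd
  exact h.1 ν 0 U₀ (isData_zero_force hν hs hd)

/-! ## F. Kernel facts at the Clay grain `f ≡ 0` (HYGIENE; nothing of the paper is asserted)

For an UNFORCED global Leray–Hopf solution on `𝕋³` the energy inequality from `0` bounds the cumulative
dissipation, `ν ∫₀ᵀ ‖∇u‖² ≤ ½‖u₀‖²` for every `T`, and `4π²|k|² · |û(k,t)|² ≤ ‖∇u(t)‖²` mode by mode; hence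
`∫₀ᵀ 𝓔(k,t) dt ≤ ½‖u₀‖²/ν` uniformly in `T` for every `k ≠ 0`, so the Cesàro spectrum EXISTS and is `Φ ≡ 0`.
Consequently, at the Clay grain (force `0`): the `f ≡ 0` face of Step 1 is TRUE, any Cesàro spectrum of the
chain's weak solution vanishes, no such spectrum obeys the K41 law with `C > 0` (Step 3 fails for EVERY
datum, not only at rest), and the hypotheses of Lemma H.1 / Lemma 4.3 (`Step4_H1`, `Step_L43`) are never met
(the census-predicted VACUITY, as a kernel fact). -/

/-- `|k|² ≥ 1` for a non-zero integer wave vector. [folklore] -/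
private theorem one_le_freqNormSq {k : Z3} (hk : k ≠ 0) : 1 ≤ Torus.freqNormSq k := by
  obtain ⟨i, hi⟩ : ∃ i, k i ≠ 0 := Function.ne_iff.mp hk
  have h1 : (1 : ℝ) ≤ (k i : ℝ) ^ 2 := by
    have : (1 : ℤ) ≤ (k i) ^ 2 := by
      rcases lt_or_gt_of_ne hi with h | h <;> nlinarith
    exact_mod_cast this
  calc (1 : ℝ) ≤ (k i : ℝ) ^ 2 := h1
    _ ≤ Torus.freqNormSq k := by
      rw [Torus.freqNormSq]
      exact Finset.single_le_sum (f := fun j => (k j : ℝ) ^ 2) (fun j _ => sq_nonneg _)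
        (Finset.mem_univ i)

/-- **Single-mode dissipation bound**: `ofReal (𝓔(k,t)) ≤ ‖∇u(t)‖²` (spectral) for `k ≠ 0`
(`𝓔(k) = ½|û(k)|² ≤ 4π²|k|²|û(k)|² ≤ 4π² Σ |k|²|û(k)|²`). [folklore] -/
private theorem ofReal_modeEnergy_le_eGradNormSq (v : T3 → E3) {k : Z3} (hk : k ≠ 0) :
    ENNReal.ofReal (modeEnergy v k) ≤ Torus.eGradNormSq v := by
  rw [Torus.eGradNormSq_eq_tsum]
  have hterm : ENNReal.ofReal (4 * Real.pi ^ 2) *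
      (ENNReal.ofReal (Torus.freqNormSq k) * ‖coeff v k‖ₑ ^ 2) ≤
      ENNReal.ofReal (4 * Real.pi ^ 2) *
        ∑' k' : Z3, ENNReal.ofReal (Torus.freqNormSq k') *
          ‖UnitAddTorus.mFourierCoeff (EuclideanSpace.complexify ∘ v) k'‖ₑ ^ 2 :=
    mul_le_mul' le_rfl (ENNReal.le_tsum k)
  refine le_trans ?_ hterm
  -- `ofReal (½‖c‖²) ≤ ‖c‖ₑ² ≤ 4π² · |k|² · ‖c‖ₑ²`
  have hc : ENNReal.ofReal (modeEnergy v k) ≤ ‖coeff v k‖ₑ ^ 2 := by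
    rw [modeEnergy, ← ofReal_norm, ← ENNReal.ofReal_pow (norm_nonneg _)]
    exact ENNReal.ofReal_le_ofReal (by nlinarith [sq_nonneg ‖coeff v k‖])
  have h1 : (1 : ℝ≥0∞) ≤ ENNReal.ofReal (4 * Real.pi ^ 2) * ENNReal.ofReal (Torus.freqNormSq k) := by
    rw [← ENNReal.ofReal_mul (by positivity), ← ENNReal.ofReal_one]
    refine ENNReal.ofReal_le_ofReal ?_
    have hπ : (1 : ℝ) ≤ 4 * Real.pi ^ 2 := by nlinarith [Real.pi_gt_three]
    nlinarith [one_le_freqNormSq hk]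
  calc ENNReal.ofReal (modeEnergy v k) ≤ 1 * ‖coeff v k‖ₑ ^ 2 := by rw [one_mul]; exact hc
    _ ≤ (ENNReal.ofReal (4 * Real.pi ^ 2) * ENNReal.ofReal (Torus.freqNormSq k)) * ‖coeff v k‖ₑ ^ 2 :=
        mul_le_mul' h1 le_rfl
    _ = _ := by rw [mul_assoc]

/-- `𝓔(k,t) ≥ 0`. [folklore] -/
private theorem modeEnergy_nonneg (v : T3 → E3) (k : Z3) : 0 ≤ modeEnergy v k := by
  rw [modeEnergy]; positivity

/-- **Uniform bound on the cumulative mode energy of an unforced Leray–Hopf solution**: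
`0 ≤ ∫₀ᵀ 𝓔(k,t) dt ≤ ½‖u₀‖²/ν` for every `T ≥ 0` and `k ≠ 0`. [folklore] -/
private theorem integral_modeEnergy_le_of_unforced {ν : ℝ} (hν : 0 < ν) {u₀ : T3 → E3}
    {u : ℝ → T3 → E3} (hu : Torus.IsGlobalLerayHopf ν 0 u₀ u) {k : Z3} (hk : k ≠ 0) {T : ℝ}
    (hT : 0 ≤ T) :
    ∫ t in (0 : ℝ)..T, modeEnergy (u t) k ≤ Torus.kineticEnergy u₀ / ν := by
  have hLH := hu (T + 1) (by linarith)
  -- the energy inequality from `0` at time `T`, force `0`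
  have hE := hLH.energy_ineq_zero T ⟨hT, by linarith⟩
  simp only [Pi.zero_apply, inner_zero_left, integral_zero, intervalIntegral.integral_zero,
    add_zero] at hE
  have hKT : 0 ≤ Torus.kineticEnergy (u T) := by
    rw [Torus.kineticEnergy]; positivity
  have hfin : ∫⁻ τ in Ioo 0 T, Torus.eGradNormSq (u τ) < ⊤ :=
    lt_of_le_of_lt (lintegral_mono_set (Ioo_subset_Ioo_right (by linarith)))
      hLH.lintegral_eGradNormSq_lt_top
  have hdiss : (∫⁻ τ in Ioo 0 T, Torus.eGradNormSq (u τ)).toReal ≤ Torus.kineticEnergy u₀ / ν := by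
    rw [le_div_iff₀ hν]; nlinarith
  -- the interval integral of the mode energy
  by_cases hint : IntervalIntegrable (fun t => modeEnergy (u t) k) volume 0 T
  · rw [intervalIntegral.integral_of_le hT]
    have hI : Integrable (fun t => modeEnergy (u t) k) (volume.restrict (Ioc 0 T)) := hint.1
    have hnn : 0 ≤ᵐ[volume.restrict (Ioc 0 T)] fun t => modeEnergy (u t) k :=
      Eventually.of_forall fun t => modeEnergy_nonneg _ _
    have hofReal : ENNReal.ofReal (∫ t in Ioc 0 T, modeEnergy (u t) k) ≤
        ∫⁻ τ in Ioo 0 T, Torus.eGradNormSq (u τ) := by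
      rw [ofReal_integral_eq_lintegral_ofReal hI hnn,
        Measure.restrict_congr_set (Ioo_ae_eq_Ioc (α := ℝ)).symm]
      exact lintegral_mono fun t => ofReal_modeEnergy_le_eGradNormSq (u t) hk
    have := (ENNReal.ofReal_le_iff_le_toReal hfin.ne).1 hofReal
    exact this.trans hdiss
  · rw [intervalIntegral.integral_undef hint]
    exact div_nonneg (by rw [Torus.kineticEnergy]; positivity) hν.le

/-- **At the Clay grain the Cesàro spectrum exists and vanishes**: every UNFORCED global Leray–Hopf
solution on `𝕋³` has Cesàro energy spectrum `Φ ≡ 0` — the `f ≡ 0` face of Step 1 (§4.3 p.16 L21–p.17 L1)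
is TRUE, for the reason that the cumulative dissipation is finite, not «by ergodicity».
[cite: LiuYong2026, §4.3 p.16 L21–p.17 L1] -/
theorem hasCesaroSpectrum_zero_of_unforced {ν : ℝ} (hν : 0 < ν) {u₀ : T3 → E3} {u : ℝ → T3 → E3}
    (hu : Torus.IsGlobalLerayHopf ν 0 u₀ u) : HasCesaroSpectrum u (fun _ => 0) := by
  intro k hk
  set B : ℝ := Torus.kineticEnergy u₀ / ν
  have hup : ∀ᶠ T : ℝ in atTop, T⁻¹ * ∫ t in (0 : ℝ)..T, modeEnergy (u t) k ≤ T⁻¹ * B := by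
    filter_upwards [eventually_ge_atTop (0 : ℝ)] with T hT
    exact mul_le_mul_of_nonneg_left (integral_modeEnergy_le_of_unforced hν hu hk hT)
      (inv_nonneg.2 hT)
  have hlow : ∀ᶠ T : ℝ in atTop, 0 ≤ T⁻¹ * ∫ t in (0 : ℝ)..T, modeEnergy (u t) k := by
    filter_upwards [eventually_ge_atTop (0 : ℝ)] with T hT
    exact mul_nonneg (inv_nonneg.2 hT)
      (intervalIntegral.integral_nonneg hT fun t _ => modeEnergy_nonneg _ _)
  have hB : Tendsto (fun T : ℝ => T⁻¹ * B) atTop (𝓝 0) := by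
    simpa using tendsto_inv_atTop_zero.mul_const B
  exact tendsto_of_tendsto_of_tendsto_of_le_of_le' tendsto_const_nhds hB hlow hup

/-- **Step 1 holds at the Clay grain** (its `f ≡ 0` face): every unforced global weak solution from smooth
divergence-free data has a Cesàro spectrum. [cite: LiuYong2026, §4.3 p.16 L21–p.17 L1] -/
theorem step1_cesaro_zeroForce {ν : ℝ} (hν : 0 < ν) {u₀ : T3 → E3} {u : ℝ → T3 → E3}
    (hu : Torus.IsGlobalLerayHopf ν 0 u₀ u) : ∃ Φ : Z3 → ℝ, HasCesaroSpectrum u Φ :=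
  ⟨fun _ => 0, hasCesaroSpectrum_zero_of_unforced hν hu⟩

/-- **Any Cesàro spectrum of an unforced Leray–Hopf solution vanishes off `k = 0`** (limits along `atTop`
are unique). [cite: LiuYong2026, §4.3 p.16 L21–p.17 L1] -/
theorem cesaroSpectrum_eq_zero_of_unforced {ν : ℝ} (hν : 0 < ν) {u₀ : T3 → E3} {u : ℝ → T3 → E3}
    (hu : Torus.IsGlobalLerayHopf ν 0 u₀ u) {Φ : Z3 → ℝ} (hΦ : HasCesaroSpectrum u Φ) {k : Z3}
    (hk : k ≠ 0) : Φ k = 0 :=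
  tendsto_nhds_unique (hΦ k hk) (hasCesaroSpectrum_zero_of_unforced hν hu k hk)

/-- **No K41 law at the Clay grain**: the Cesàro spectrum of an unforced global Leray–Hopf solution on `𝕋³`
never satisfies `Φ(k)|k|^{5/3} → C > 0` — so Step 3 (p.18 L22–L23) fails for EVERY unforced datum, and the
hypotheses of Lemma H.1 p.57 L8 (`Step4_H1`) and of Lemma 4.3 p.18 (`Step_L43`) are never met when `f ≡ 0`
(vacuity at the Clay grain, kernel form). [cite: LiuYong2026, 引理H.1 p.57 L8; 命题4.4 proof p.18 L22–L23] -/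
theorem not_isK41_of_unforced {ν : ℝ} (hν : 0 < ν) {u₀ : T3 → E3} {u : ℝ → T3 → E3}
    (hu : Torus.IsGlobalLerayHopf ν 0 u₀ u) {Φ : Z3 → ℝ} (hΦ : HasCesaroSpectrum u Φ) : ¬ IsK41 Φ := by
  rintro ⟨C, hC, hT⟩
  have hzero : ∀ᶠ k : Z3 in cofinite, Φ k * klen k ^ (5 / 3 : ℝ) = 0 := by
    have : ∀ᶠ k : Z3 in cofinite, k ≠ 0 := (Set.finite_singleton (0 : Z3)).eventually_cofinite_notMem
    filter_upwards [this] with k hk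
    rw [cesaroSpectrum_eq_zero_of_unforced hν hu hΦ hk, zero_mul]
  have h0 : Tendsto (fun k : Z3 => Φ k * klen k ^ (5 / 3 : ℝ)) cofinite (𝓝 0) :=
    (tendsto_congr' hzero).2 tendsto_const_nhds
  haveI : (cofinite : Filter Z3).NeBot := cofinite_neBot
  have := tendsto_nhds_unique hT h0
  linarith

/-- **Vacuity of Step 4 at the Clay grain, packaged**: for force `0` the four hypotheses of `Step4_H1`
(Leray–Hopf, Cesàro spectrum, K41, infrared bound) are contradictory. [cite: LiuYong2026, 引理H.1 p.57 L8–L10] -/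
theorem step4_hypotheses_vacuous_zeroForce {ν : ℝ} (hν : 0 < ν) {u₀ : T3 → E3} {u : ℝ → T3 → E3}
    {Φ : Z3 → ℝ} (hu : Torus.IsGlobalLerayHopf ν 0 u₀ u) (hΦ : HasCesaroSpectrum u Φ) (hK : IsK41 Φ) :
    False :=
  not_isK41_of_unforced hν hu hΦ hK

/-! ## G. The one-sided face of Step 3 (RULED (γ), ns-claims-lead-1 g4 2026-08-27T07:47:20Z; REF charity column)

The chair's records-grade commission: the charitable ONE-SIDED re-typing of Step 3 — conclusion `IsK41Upper`
(«Φ(k) ≤ C|k|^{−5/3} for large |k|», the grain the proof of Lemma H.1 p.57 L13 actually consumes) in place of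
the two-sided `IsK41` — as a typed face `Step3_K41_upper`, with the link `step3_upper_of_step3` (the printed
Step 3 implies its one-sided face), the face-fact `isK41Upper_of_unforced` (the one-sided face is TRUE on the
unforced / Clay face, with `C = 0`, `k₀ = 1`, by §F), and the composition VARIANT `claim_of_steps_upper`
through `Step4_H1_upper` (so that an adjudication of the one-sided face is ON PATH of a kernel composition).
Nothing of the paper is asserted; no rev-1/rev-2 declaration is touched. -/

/-- **A K41 upper bound makes the spectrum infrared-bounded on the lattice** (finitely many modes below
`max k₀ 1`, the bound `C|k|^{−5/3} ≤ |C|` above) — the bookkeeping used inside `claim_of_steps`, exposed for the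
one-sided variant. [cite: LiuYong2026, 引理H.1 p.57 L8, L13] -/
theorem infraredBounded_of_isK41Upper {Φ : Z3 → ℝ} (h : IsK41Upper Φ) : InfraredBounded Φ := by
  classical
  obtain ⟨C, k₀, hCk⟩ := h
  have hfin : {k : Z3 | klen k < max k₀ 1}.Finite := finite_klen_lt _
  obtain ⟨B₀, hB₀⟩ := (hfin.image Φ).bddAbove
  refine ⟨max B₀ (|C|), fun k => ?_⟩
  by_cases hk : klen k < max k₀ 1
  · exact (hB₀ (Set.mem_image_of_mem Φ hk)).trans (le_max_left _ _)
  · have hk' : max k₀ 1 ≤ klen k := not_lt.1 hk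
    have hk1 : 1 ≤ klen k := (le_max_right k₀ 1).trans hk'
    have h1 : Φ k ≤ C * klen k ^ (-(5 / 3 : ℝ)) := hCk k ((le_max_left k₀ 1).trans hk')
    have h2 : klen k ^ (-(5 / 3 : ℝ)) ≤ 1 :=
      Real.rpow_le_one_of_one_le_of_nonpos hk1 (by norm_num)
    have h3 : C * klen k ^ (-(5 / 3 : ℝ)) ≤ |C| := by
      have hnn : 0 ≤ klen k ^ (-(5 / 3 : ℝ)) := Real.rpow_nonneg (klen_nonneg k) _
      calc C * klen k ^ (-(5 / 3 : ℝ)) ≤ |C| * klen k ^ (-(5 / 3 : ℝ)) :=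
            mul_le_mul_of_nonneg_right (le_abs_self C) hnn
        _ ≤ |C| * 1 := mul_le_mul_of_nonneg_left h2 (abs_nonneg C)
        _ = |C| := mul_one _
    exact (h1.trans h3).trans (le_max_right _ _)

/-- **Step 3, ONE-SIDED face** (RULED (γ) 07:47:20Z; the charitable re-typing of 引理4.2 p.17 L4–p.18 L5 +
命题4.4 proof p.18 L22–L23 at the grain the proof of 引理H.1 consumes, p.57 L13 «由于 Φ(k) ≤ C|k|^{−5/3} 对大 k»):
the Cesàro spectrum of EVERY global weak solution of the forced problem from the data of Thm 1 obeys the K41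
UPPER bound `Φ(k) ≤ C|k|^{−5/3}` for `|k| ≥ k₀`. Weaker than `Step3_K41` (`step3_upper_of_step3`); TRUE on the
unforced face (`isK41Upper_of_unforced`). [claim: LiuYong2026, status: disputed] -/
def Step3_K41_upper : Prop :=
  ∀ (ν : ℝ) (f : ℝ → T3 → E3) (u₀ : T3 → E3), IsData ν f u₀ →
    ∀ (u : ℝ → T3 → E3) (Φ : Z3 → ℝ), Torus.IsGlobalLerayHopf ν f u₀ u → HasCesaroSpectrum u Φ →
      IsK41Upper Φ

/-- The printed (two-sided, `C > 0`) Step 3 implies its one-sided face. [cite: LiuYong2026, 引理H.1 p.57 L13] -/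
theorem step3_upper_of_step3 (h : Step3_K41) : Step3_K41_upper :=
  fun ν f u₀ hd u Φ hu hΦ => isK41Upper_of_isK41 (h ν f u₀ hd u Φ hu hΦ)

/-- `|0| = 0`. [folklore] -/
private theorem klen_zero : klen (0 : Z3) = 0 := by
  simp [klen, Torus.freqNormSq]

/-- **Face-fact: the one-sided face of Step 3 is TRUE on the unforced (Clay) face**, with `C = 0`, `k₀ = 1`:
any Cesàro spectrum of an unforced global Leray–Hopf solution vanishes off `k = 0` (§F
`cesaroSpectrum_eq_zero_of_unforced`). [cite: LiuYong2026, 引理H.1 p.57 L13; §4.3 p.16 L21–p.17 L1] -/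
theorem isK41Upper_of_unforced {ν : ℝ} (hν : 0 < ν) {u₀ : T3 → E3} {u : ℝ → T3 → E3}
    (hu : Torus.IsGlobalLerayHopf ν 0 u₀ u) {Φ : Z3 → ℝ} (hΦ : HasCesaroSpectrum u Φ) : IsK41Upper Φ := by
  refine ⟨0, 1, fun k hk => ?_⟩
  have hk0 : k ≠ 0 := by
    rintro rfl
    rw [klen_zero] at hk
    exact absurd hk (by norm_num)
  rw [cesaroSpectrum_eq_zero_of_unforced hν hu hΦ hk0, zero_mul]

/-- **COMPOSITION VARIANT at the one-sided grain**: Steps 0, 1, 3ᵘ (`Step3_K41_upper`), 4ᵘ (`Step4_H1_upper`),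
5, 6 imply Theorem 1 (Step 2 `_`, as in `claim_of_steps`). A refutation of `Step3_K41_upper` or of
`Step4_H1_upper` is therefore ON PATH of this VARIANT composition only — the adjudicated token of row #119
stays `Step3_K41` / `claim_of_steps` (VERDICT refuter-5 g3 2026-08-27T07:59:30Z); do not re-key on the variant.
[cite: LiuYong2026, §4.2 p.16 L4–L14; 引理H.1 p.57 L13] -/
theorem claim_of_steps_upper (h0 : Step0_Leray) (h1 : Step1_cesaro) (_h2 : Step2_orbits)
    (h3 : Step3_K41_upper) (h4 : Step4_H1_upper) (h5 : Step5_lift) (h6 : Step6_unique) :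
    ClaimedTheorem := by
  refine ⟨fun ν f u₀ hd => ?_, h6⟩
  obtain ⟨u, hu⟩ := h0 ν f u₀ hd
  obtain ⟨Φ, hΦ⟩ := h1 ν f u₀ hd u hu
  have hK : IsK41Upper Φ := h3 ν f u₀ hd u Φ hu hΦ
  have hS : UniformSobolevBounds u := h4 ν f u₀ hd u Φ hu hΦ hK (infraredBounded_of_isK41Upper hK)
  obtain ⟨U, P, hU, hU0, -⟩ := h5 ν f u₀ hd u hu hS
  exact ⟨U, P, hU, hU0⟩

/-- The one-sided composition with the classical ends discharged (`Step0_Leray_holds`, `Step6_unique_holds`).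
[cite: LiuYong2026, §4.2 p.16 L4–L14] -/
theorem claim_of_steps_upper₀ (h1 : Step1_cesaro) (_h2 : Step2_orbits) (h3 : Step3_K41_upper)
    (h4 : Step4_H1_upper) (h5 : Step5_lift) : ClaimedTheorem :=
  claim_of_steps_upper Step0_Leray_holds h1 _h2 h3 h4 h5 Step6_unique_holds

end Literature.Claims.NS.LiuYong2026

end
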